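import Mathlib
import HarnessLib
import Summits.HubbardSuperconductivity.HubbardSuperconductivity.Theorems.KLProgrammeKLRegimeSplitChildOneClosersS2
import Summits.HubbardSuperconductivity.HubbardSuperconductivity.Theorems.KLProgrammeKLRegimeSplitChildOneClosers

/-!
# Route `KLProgramme`, crux K3 (stmt-HubbardSuperconductivity-19937), child 1 `KLRegimeBetaSplit` on the `Q`-staged slots (Δ15) — the
# PER-SCALE STEP: `BetaSplitAtS2 n` from row 0′'s `PairArrayAtV2 n`, the engine slot `EngineBoundsAtV5S n` and three arithmetic side
# conditions on the constants

Cell gate-hubbard-kl, seat p1b (g4; child-1 co-owner).  The S2/V5S twin of `betaSplitAtS_of_engineV4S` (`…SplitChildOneStepV6`, p1b g3), for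
the V7 bundle `klPredsV7 := { FrameOK, RenormalisedAtF, BetaSplitAtS2, EngineBoundsAtV5S, TwoLegStepV7 }` (plan g10 2026-08-26 14:03:10Z slot
table; p1's `…SplitLegStaging` p450191).  Composition of the landed pieces: (B1-v2′) `PairArrayAtV2 n` is row 0′'s output at the `Q`-aware
tolerance `(P.C_W + klLegKappa·Q.CR·P.Klam³)·U²` (hubbard-kl-r2d-p1, from `PairLadderStepAtV5` over the history); (B2-S) `EndpointLineS n` ⇐
`PairArrayAtV2 n ∧ IsoTupleL1AtS n` with the value bound `B₂ = 2|U| + (C_W + κ₀·CR·Klam³)U²` (p1 `endpointLineS_of_V2`, `…ChildOneClosersS2`);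
(B4) `FirstMoments n` ⇐ (E4) `EngineFirstMoments n` (p1 `firstMoments_of_engineFirstMoments`, `…ChildOneClosers`).  The side conditions are the
V6 ones with `C_W ↦ C_W + klLegKappa·Q.CR·P.Klam³`; they are met by child 1's constant choices `P.Klam := 2·G.CF + 3`, `P.Cd := G.cE4 + 1` and
`U ≤ U₀(G, P, Q)` exactly as in `betaSplitP_of_slotsS` (`…KLRegimeBetaSplitV6`, lemma `klbs_value_consts` read at the widened `C_W`; `Q` is
known when `U₀` is chosen).  So the child-1 item at V7 reduces to row 0′ (v5 leg majorant) + this lemma + the constants/threshold bookkeeping.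
Bundle-free (slot level): the `klPredsV7.split`-named wrapper lands next to the bundle.  Nothing is asserted about the model.
-/

noncomputable section

namespace Summit.HubbardSuperconductivity.HubbardSuperconductivity.Theorems.KLRegimeSplit

set_option linter.dupNamespace false -- summit = problem name (single-conjunct summit), D-0017

open Literature.MathematicalPhysics.QuantumLattice Literature.Probability.LatticeModels

section Model

variable (L M : ℕ) [NeZero L] [NeZero M]

/-- **The per-scale child-1 step at the S2/V5S slots**: `PairArrayAtV2 n` (row 0′, `Q`-aware tolerance) and `EngineBoundsAtV5S n` give
`BetaSplitAtS2 n`, under the arithmetic side conditions `CF·B₂ + CF·(Klam U)² ≤ Klam|U|`, `B₂ ≤ Klam|U|`, `cE4 + cE4′|U| ≤ Cd` with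
`B₂ := 2|U| + (C_W + klLegKappa·CR·Klam³)·U²` (`0 ≤ B₂`, `0 ≤ Klam`). -/
theorem betaSplitAtS2_of_engineV5S {G : GeoConsts} (P : SplitConsts) (Q : EngConsts) {β U μ : ℝ} {K : TrigPolyC4v} {n : ℕ}
    (hU : 0 ≤ 2 * |U| + (P.C_W + klLegKappa * Q.CR * P.Klam ^ 3) * U ^ 2) (hP : 0 ≤ P.Klam)
    (hpair : PairArrayAtV2 L M P Q β U μ K n) (hE : EngineBoundsAtV5S L M G P Q β U μ K n)
    (harith : G.CF * (2 * |U| + (P.C_W + klLegKappa * Q.CR * P.Klam ^ 3) * U ^ 2) + G.CF * (P.Klam * U) ^ 2 ≤ P.Klam * |U|)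
    (hK : 2 * |U| + (P.C_W + klLegKappa * Q.CR * P.Klam ^ 3) * U ^ 2 ≤ P.Klam * |U|) (hCd : G.cE4 + Q.cE4 * |U| ≤ P.Cd) :
    BetaSplitAtS2 L M G P Q β U μ K n :=
  ⟨hpair, endpointLineS_of_V2 L M P Q hU hpair hE.2.2.2.2.2.2.2 harith hK,
    firstMoments_of_engineFirstMoments L M hP hCd hE.2.2.2.2.2.2.1⟩

/-- **The same with the engine clauses named**: (E5-S) `IsoTupleL1AtS n` and (E4) `EngineFirstMoments n` are the only engine conjuncts the
step reads (besides row 0′'s own inputs). -/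
theorem betaSplitAtS2_of_pairArrayAtV2 {G : GeoConsts} (P : SplitConsts) (Q : EngConsts) {β U μ : ℝ} {K : TrigPolyC4v} {n : ℕ}
    (hU : 0 ≤ 2 * |U| + (P.C_W + klLegKappa * Q.CR * P.Klam ^ 3) * U ^ 2) (hP : 0 ≤ P.Klam)
    (hpair : PairArrayAtV2 L M P Q β U μ K n) (hiso : IsoTupleL1AtS L M G P β U μ K n)
    (hE4 : EngineFirstMoments L M G P Q β U μ K n)
    (harith : G.CF * (2 * |U| + (P.C_W + klLegKappa * Q.CR * P.Klam ^ 3) * U ^ 2) + G.CF * (P.Klam * U) ^ 2 ≤ P.Klam * |U|)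
    (hK : 2 * |U| + (P.C_W + klLegKappa * Q.CR * P.Klam ^ 3) * U ^ 2 ≤ P.Klam * |U|) (hCd : G.cE4 + Q.cE4 * |U| ≤ P.Cd) :
    BetaSplitAtS2 L M G P Q β U μ K n :=
  ⟨hpair, endpointLineS_of_V2 L M P Q hU hpair hiso harith hK, firstMoments_of_engineFirstMoments L M hP hCd hE4⟩

/-- What `EngineBoundsAtV5S n` hands row 0′ and the step: (E2-v5) `PairLadderStepAtV5 n`, (E2″-v5) `PairValueIncrementAtV5 n`,
(E4) `EngineFirstMoments n`, (E5-S) `IsoTupleL1AtS n`. -/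
theorem engineBoundsAtV5S_rowZero_inputs {G : GeoConsts} {P : SplitConsts} {Q : EngConsts} {β U μ : ℝ} {K : TrigPolyC4v} {n : ℕ}
    (hE : EngineBoundsAtV5S L M G P Q β U μ K n) :
    PairLadderStepAtV5 L M G P Q β U μ K n ∧ PairValueIncrementAtV5 L M G P Q β U μ K n ∧
      EngineFirstMoments L M G P Q β U μ K n ∧ IsoTupleL1AtS L M G P β U μ K n :=
  ⟨hE.2.2.1, hE.2.2.2.1, hE.2.2.2.2.2.2.1, hE.2.2.2.2.2.2.2⟩

end Model

/-! ## The arithmetic side conditions at the widened width (for the constants bookkeeping of `BetaSplitP … klPredsV7`) -/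

/-- **The value/iso constants at the `Q`-aware width**: with `Klam = 2·CF + 3`, `C₂ := C_W + klLegKappa·CR·Klam³` and
`(C₂ + CF·C₂ + CF·Klam²)·U ≤ 1`, `0 ≤ U`: `2U + C₂U² ≤ Klam·U` and `CF·(2U + C₂U²) + CF·(Klam U)² ≤ Klam·U` — the two side conditions of
`betaSplitAtS2_of_engineV5S` at `|U| = U`.  (`C₂ ≥ 0` needs `C_W, CR ≥ 0`, `Klam ≥ 0`.) -/
theorem klbs2_value_consts {CF CW CR Klam U : ℝ} (hCF : 0 ≤ CF) (hCW : 0 ≤ CW) (hCR : 0 ≤ CR) (hK : Klam = 2 * CF + 3)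
    (hU : 0 ≤ U)
    (hD : ((CW + klLegKappa * CR * Klam ^ 3) + CF * (CW + klLegKappa * CR * Klam ^ 3) + CF * Klam ^ 2) * U ≤ 1) :
    2 * U + (CW + klLegKappa * CR * Klam ^ 3) * U ^ 2 ≤ Klam * U ∧
      CF * (2 * U + (CW + klLegKappa * CR * Klam ^ 3) * U ^ 2) + CF * (Klam * U) ^ 2 ≤ Klam * U := by
  have hKlam0 : 0 ≤ Klam := by rw [hK]; linarith
  have hκ : 0 ≤ klLegKappa := by unfold klLegKappa; norm_num
  set C₂ : ℝ := CW + klLegKappa * CR * Klam ^ 3 with hC₂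
  have hC₂0 : 0 ≤ C₂ := by rw [hC₂]; positivity
  have hK2 : 0 ≤ Klam ^ 2 := sq_nonneg _
  have h1 : C₂ * U ≤ 1 := by nlinarith [mul_nonneg hCF hC₂0, mul_nonneg hCF hK2]
  have h2 : (CF * C₂ + CF * Klam ^ 2) * U ≤ 1 := by nlinarith [mul_nonneg hCF hC₂0, mul_nonneg hCF hK2]
  constructor
  · have h3 : C₂ * U * U ≤ 1 * U := mul_le_mul_of_nonneg_right h1 hU
    have h4 : 3 * U ≤ Klam * U := by rw [hK]; nlinarith
    have e : 2 * U + C₂ * U ^ 2 = 2 * U + C₂ * U * U := by ring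
    rw [e]; linarith
  · have h3 : (CF * C₂ + CF * Klam ^ 2) * U * U ≤ 1 * U := mul_le_mul_of_nonneg_right h2 hU
    have h4 : (2 * CF + 1) * U ≤ Klam * U := by rw [hK]; nlinarith
    have e : CF * (2 * U + C₂ * U ^ 2) + CF * (Klam * U) ^ 2 = 2 * CF * U + (CF * C₂ + CF * Klam ^ 2) * U * U := by ring
    rw [e]; linarith

/-- **A sufficient smallness of `U` for the widened side conditions**: `U ≤ 1/(D₂ + 1)` with
`D₂ := C₂ + CF·C₂ + CF·Klam²` (`C₂ := C_W + klLegKappa·CR·Klam³`) gives `D₂·U ≤ 1` (any sign of `U`). -/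
theorem klbs2_smallness_of_le_inv {D U : ℝ} (hD : 0 ≤ D) (h : U ≤ 1 / (D + 1)) : D * U ≤ 1 := by
  have hD1 : 0 < D + 1 := by linarith
  have h1 : D * U ≤ D * (1 / (D + 1)) := mul_le_mul_of_nonneg_left h hD
  have h2 : D * (1 / (D + 1)) ≤ 1 := by
    rw [mul_one_div, div_le_one hD1]; linarith
  exact h1.trans h2

end Summit.HubbardSuperconductivity.HubbardSuperconductivity.Theorems.KLRegimeSplit

end
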